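import Literature.NumberTheory.EllipticCurves.Kato2004.IwasawaH2FineSelmerDualComparison
import Literature.NumberTheory.EllipticCurves.Kato2004.IwasawaCohomologyExistsProofs
import Literature.NumberTheory.EllipticCurves.Kato2004.IwasawaH1RankLowerBoundProofs
import Literature.NumberTheory.EllipticCurves.Kato2004.IwasawaH1ProjZeroKernelProofs
import Literature.NumberTheory.EllipticCurves.Kato2004.IwasawaH1LambdaTorsionFreeProofs
import Literature.NumberTheory.EllipticCurves.Kato2004.LocPKernelRankOnePlumbing
import Literature.NumberTheory.EllipticCurves.Kato2004.IntegralH1FiniteProofs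
import Literature.NumberTheory.EllipticCurves.IwasawaTowerTorsionOrdinaryLocalProofs
import Literature.NumberTheory.EllipticCurves.IwasawaEulerCharProofs
import Literature.NumberTheory.EllipticCurves.SelmerCorankControlProofs
import Literature.NumberTheory.EllipticCurves.BSDSelmerPConverseRationalHeegnerDescentProofs
import Literature.NumberTheory.EllipticCurves.KatoRankBoundProofs
import HarnessLib

/-!
# Kato 2004 (Astérisque 295) §14.14 (14.14.1) read at the prime `(T)`: the DESCENT COUNT for the dual
# fine Selmer group — `ℓ_T(X₀(E/ℚ_∞)) ≤ 1` from `T`-semisimplicity of `X₀` and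
# `rank_{ℤ_p} H¹(ℤ[1/p], T_pW) ≤ 2` (proofs only)

Topic `NumberTheory/EllipticCurves`, sub-directory `Kato2004` (namespace = path). THEOREMS ONLY (no
definition, no named fact, no `instance`, no notation, no `sorry`). Prover seat `bsd-line-dkd-p1` g1
(LEAD of crux stmt-BirchSwinnertonDyer-23259 `FineLengthLeOneOfAnalyticRankTwo`, route
`DerivedKatoValuationDoor`, line `descent` = `Summits/…/Cruxes/FineLengthLeOneOfAnalyticRankTwo/Lines/descent.lean`):
this file is the SORRY-FREE algebraic heart of that line, moved to the Literature layer because it is a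
statement about Kato's packages `IwasawaH1Data` / `IwasawaH2Data` and the constructed dual fine Selmer
group `WeierstrassCurve.fineSelmerDualData`, with no Summits vocabulary in it. HONEST FRAMING: nothing
about BSD, the main conjecture or the open stubs of the line is asserted; the two named facts that enter
(`exists_iwasawaH2Data_fineSelmerDual_embedding` = Kato (14.9.1)/(17.13.1), and `one_le_rank_iwasawaH1` =
(12.2.2)) enter as DISPLAYED HYPOTHESES of the theorems that need them.

## The count (Kato (14.14.1) at `𝔭_T = (T)`; `ℓ_T = Module.lengthAt Λ · (primeT p)`)

For an elliptic `W/ℚ`, a prime `p`, a cyclotomic `κ` with topological generator `γ`, a pin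
`I : IwasawaH1Data W p κ γ` (`𝐇¹ = I.H`) and a descent package `J : IwasawaH2Data W p κ γ I`
(`A = J.A = H¹(ℤ[1/p], T_pW)` pinned to `integralH1`, `𝐇² = J.H2`, (14.14.1) `0 → 𝐇¹/T𝐇¹ →ι A →π 𝐇²[T] → 0`):

* `IwasawaH2Data.lengthAt_A_eq_coinvariants_add_invariants`: **`ℓ_T(A) = ℓ_T(𝐇¹/T𝐇¹) + ℓ_T(𝐇²[T])`**
  (additivity of local lengths on (14.14.1), `𝐇²[T]` pinned as `coker ι`);
* `IwasawaH2Data.lengthAt_A_le_toENat_rank_integralH1`: **`ℓ_T(A) ≤ rank_{ℤ_p} H¹(ℤ[1/p], T_pW)`** (`T` acts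
  as `0` on `A`, so `ℓ_T(A) = rank_{ℤ_p} A`; the pin `toH1` + `layerZeroToTop` embeds `A` `ℤ_p`-linearly
  in `integralH1 (tateRep W p) p ⊤`);
* `IwasawaH1Data.one_le_lengthAt_coinvariants_of_one_le_rank`: **`1 ≤ ℓ_T(𝐇¹/T𝐇¹)`** from (12.2.2)
  (`𝐇¹` is finitely generated — `IwasawaH1Data.module_finite_of_isCyclotomic` — and torsion free —
  `IwasawaH1Data.isTorsionFree` —, both tree theorems; non-trivial by the fact);
* `IwasawaAlgebra.lengthAt_invariants_le_of_injective`: `ℓ_T(M[T]) ≤ ℓ_T(N[T])` for `M ↪ N`;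
* `exists_iwasawaH2Data_fineSelmerDual_embedding_of_goodOrdinary`: the Poitou–Tate embedding
  `X₀ ↪ 𝐇²` at an ODD GOOD ORDINARY prime with Imai's finiteness DISCHARGED by the tree theorem
  `WeierstrassCurve.finite_fixedPoints_kerSubgroup_inf_decomp_of_ordinary`;
* **`WeierstrassCurve.fineSelmerDual_lengthAt_le_one_of_TSubmodule_of_rank_le_two`** (the count): at an
  odd good ordinary prime, along every cyclotomic datum, `ℓ_T(T·X₀) = 0` (the localisation `X₀_(T)` is
  killed by `T`: `T`-semisimplicity) and `rank_{ℤ_p} H¹(ℤ[1/p], T_pW) ≤ 2` give `ℓ_T(X₀) ≤ 1`: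
  `ℓ_T(X₀) = ℓ_T(X₀[T]) + ℓ_T(T X₀) = ℓ_T(X₀[T]) ≤ ℓ_T(𝐇²[T]) = ℓ_T(A) − ℓ_T(𝐇¹/T𝐇¹) ≤ 2 − 1`;
* `IwasawaAlgebra.lengthAt_TSubmodule_eq_zero_of_lengthAt_le_one` (converse bookkeeping):
  `ℓ_T(X) ≤ 1 ∧ 1 ≤ ℓ_T(X[T]) ⇒ ℓ_T(T X) = 0`.

In print the two hypotheses of the count are, for `E/ℚ` of rank `2` at a good ordinary `p` with `ρ̄`
onto: Greenberg's `T`-semisimplicity of the fine Selmer dual (Kurihara–Pollack, Problem 0.7 — the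
`(T)`-part of `char X₀(E/ℚ_∞) = (∏ Φ_n^{e_n−1})` at `r = 2` is `ℓ_T(X₀) = 1`) and
`rank H¹(ℤ[1/p], T_pW) = 1 + rank H²(ℤ[1/p], T_pW) ≤ 2` (strict Selmer rank `≤ 1`; Poitou–Tate, the image
of `loc_p` being one line). Neither is claimed here.

## References

* K. Kato, *p-adic Hodge theory and values of zeta functions of modular forms*, Astérisque 295 (2004):
  §8.2 / Lemma 8.5 (pp. 180–184), §12.2 (12.2.1)–(12.2.2) (p. 220), Thm. 12.4 (p. 221), (14.9.1) (p. 239),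
  §14.14 (14.14.1) (p. 243). [Kato2004Asterisque]
* M. Kurihara, R. Pollack, *Two p-adic L-functions and rational points on elliptic curves with
  supersingular reduction*, LMS LNS 320 (2007), Problem 0.7 (p. 352 of the volume) and §3.1. [KuriharaPollack2007]
* R. Greenberg, *Iwasawa theory for elliptic curves*, LNM 1716 (1999), §1 (after Conj. 1.12). [GreenbergLNM1716]
* H. Imai, Proc. Japan Acad. 51 (1975), Theorem (p. 12). [Imai1975]
* L. Washington, *Introduction to Cyclotomic Fields*, §13.2. [Washington1997]
* Tree: `Kato2004/IwasawaH2Descent.lean` (`IwasawaH2Data`, `invariantsEquivCoker`),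
  `Kato2004/IwasawaH2FineSelmerDualComparison.lean` (the embedding fact), `Kato2004/IwasawaH1RankLowerBound*.lean`
  ((12.2.2)), `IwasawaEulerCharProofs.lean` (`invariants`, `TSubmodule`, length algebra at `(T)`),
  `SelmerCorankControlProofs.lean` (`lengthAt_eq_toENat_rank_of_X_smul_eq_zero`),
  `IwasawaTowerTorsionOrdinaryLocalProofs.lean` (Imai at ordinary `p`).
-/

noncomputable section

open scoped NumberField
open Field IsDedekindDomain
open Literature.NumberTheory.GaloisRepresentations
open Literature.NumberTheory.EllipticCurves Literature.NumberTheory.EllipticCurves.IwasawaAlgebra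
open Literature.NumberTheory.EllipticCurves.Kato2004.EulerSystemValues

namespace Literature.NumberTheory.EllipticCurves

/-! ## §1 Generic length bookkeeping at `(T)` -/

namespace IwasawaAlgebra

variable {p : ℕ} [Fact p.Prime]

/-- **`ℓ_T(M[T]) ≤ ℓ_T(N[T])` for an injective `Λ`-linear `M → N`** (`invariantsMap` of an injection is
injective; localisation at `(T)` is exact; Bourbaki AC II §2.4). [cite: Washington1997, §13.2] -/
theorem lengthAt_invariants_le_of_injective {M N : Type*} [AddCommGroup M]
    [Module (IwasawaAlgebra p) M] [AddCommGroup N] [Module (IwasawaAlgebra p) N]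
    (e : M →ₗ[IwasawaAlgebra p] N) (he : Function.Injective e) :
    Module.lengthAt (IwasawaAlgebra p) ↥(invariants p M) (primeT p) ≤
      Module.lengthAt (IwasawaAlgebra p) ↥(invariants p N) (primeT p) :=
  Module.lengthAt_le_of_injective (invariantsMap e) (invariantsMap_injective e he) (primeT p)

/-- **`ℓ_T(X) ≤ 1` and `1 ≤ ℓ_T(X[T])` force `ℓ_T(T·X) = 0`** — read off
`ℓ_T(X) = ℓ_T(X[T]) + ℓ_T(T·X)` (`lengthAt_eq_invariants_add_TSubmodule`) in `ℕ∞`. (For a finitely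
generated torsion `X` with one `T`-block this says: `ℓ_T(X) ≤ 1` makes `X` semisimple at `T`.)
[cite: Washington1997, §13.2] -/
theorem lengthAt_TSubmodule_eq_zero_of_lengthAt_le_one {X : Type*} [AddCommGroup X]
    [Module (IwasawaAlgebra p) X]
    (hX : Module.lengthAt (IwasawaAlgebra p) X (primeT p) ≤ 1)
    (hinv : 1 ≤ Module.lengthAt (IwasawaAlgebra p) ↥(invariants p X) (primeT p)) :
    Module.lengthAt (IwasawaAlgebra p) ↥(TSubmodule p X) (primeT p) = 0 := by
  have h := lengthAt_eq_invariants_add_TSubmodule p X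
  have hle : Module.lengthAt (IwasawaAlgebra p) ↥(invariants p X) (primeT p) +
      Module.lengthAt (IwasawaAlgebra p) ↥(TSubmodule p X) (primeT p) ≤ 1 := by
    rw [← h]; exact hX
  have hinv' : Module.lengthAt (IwasawaAlgebra p) ↥(invariants p X) (primeT p) ≠ ⊤ :=
    ne_top_of_le_ne_top ENat.one_ne_top ((le_add_right le_rfl).trans hle)
  have h2 : Module.lengthAt (IwasawaAlgebra p) ↥(invariants p X) (primeT p) +
      Module.lengthAt (IwasawaAlgebra p) ↥(TSubmodule p X) (primeT p) ≤
        Module.lengthAt (IwasawaAlgebra p) ↥(invariants p X) (primeT p) + 0 := by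
    rw [add_zero]; exact hle.trans hinv
  exact nonpos_iff_eq_zero.mp ((ENat.add_le_add_iff_left hinv').mp h2)

end IwasawaAlgebra

/-! ## §2 The (14.14.1) count on Kato's packages -/

namespace Kato2004

variable {W : WeierstrassCurve ℚ} [W.IsElliptic] {p : ℕ} [Fact p.Prime]
  [ContinuousSMul ℤ_[p] (W.tateModule p)] {κ : ZpExtension ℚ p} {γ : absoluteGaloisGroup ℚ}

/-- **`ℓ_T(A) = ℓ_T(𝐇¹/T𝐇¹) + ℓ_T(𝐇²[T])`** on a descent package `J` — additivity of local lengths on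
(14.14.1) `0 → 𝐇¹/T𝐇¹ →ι A → A/ι(𝐇¹/T𝐇¹) → 0` and the package's `A/ι(𝐇¹/T𝐇¹) ≅ 𝐇²[T]`
(`invariantsEquivCoker`). [cite: Kato2004Asterisque, §14.14 (14.14.1) (p. 243)] -/
theorem IwasawaH2Data.lengthAt_A_eq_coinvariants_add_invariants {I : IwasawaH1Data W p κ γ}
    (J : IwasawaH2Data W p κ γ I) :
    Module.lengthAt (IwasawaAlgebra p) J.A (primeT p) =
      Module.lengthAt (IwasawaAlgebra p) (coinvariants p I.H) (primeT p) +
        Module.lengthAt (IwasawaAlgebra p) ↥(invariants p J.H2) (primeT p) := by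
  rw [Module.lengthAt_eq_add_of_exact J.ι (LinearMap.range J.ι).mkQ J.ι_injective
      (Submodule.mkQ_surjective _) (LinearMap.exact_map_mkQ_range J.ι) (primeT p),
    Module.lengthAt_eq_of_linearEquiv J.invariantsEquivCoker (primeT p)]

/-- **`ℓ_T(A) ≤ rank_{ℤ_p} H¹(ℤ[1/p], T_pW)`** (in `ℕ∞`, through `Cardinal.toENat`): `T` acts as `0` on `A`
(`X_smul_eq_zero`), so `ℓ_T(A) = rank_{ℤ_p} A` for the `ℤ_p`-structure through the constants
(`lengthAt_eq_toENat_rank_of_X_smul_eq_zero`), and `layerZeroToTop ∘ toH1` is an injective `ℤ_p`-linear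
map `A ↪ integralH1 (tateRep W p) p ⊤` (the pin of `A`, §8.2 / Lemma 8.5).
[cite: Kato2004Asterisque, §8.2 and Lemma 8.5 (pp. 180–184), §14.14 (p. 243)] -/
theorem IwasawaH2Data.lengthAt_A_le_toENat_rank_integralH1 {I : IwasawaH1Data W p κ γ}
    (J : IwasawaH2Data W p κ γ I) :
    Module.lengthAt (IwasawaAlgebra p) J.A (primeT p) ≤
      Cardinal.toENat (Module.rank ℤ_[p] ↥(integralH1 (tateRep W p) p ⊤)) := by
  letI : Module ℤ_[p] J.A := Module.compHom J.A (algebraMap ℤ_[p] (IwasawaAlgebra p))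
  haveI : IsScalarTower ℤ_[p] (IwasawaAlgebra p) J.A :=
    IsScalarTower.of_algebraMap_smul fun _ _ => rfl
  have hA : Module.lengthAt (IwasawaAlgebra p) J.A (primeT p) = Cardinal.toENat (Module.rank ℤ_[p] J.A) :=
    lengthAt_eq_toENat_rank_of_X_smul_eq_zero p J.X_smul_eq_zero (primeT p) (primeT_asIdeal p)
  -- the pin, as an injective `ℤ_p`-linear map into `integralH1 … ⊤`
  let f : J.A →ₗ[ℤ_[p]] ↥(integralH1 (tateRep W p) p ⊤) :=
    { toFun := fun a => ⟨layerZeroToTop W p κ (J.toH1 a),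
        layerZeroToTop_mem_integralH1 W p κ (J.toH1_mem a)⟩
      map_add' := fun a b => Subtype.ext (by
        simp only [map_add, Submodule.coe_add])
      map_smul' := fun c a => Subtype.ext (by
        simp only [RingHom.id_apply, Submodule.coe_smul]
        rw [← layerZeroToTop_smul]
        congr 1
        change J.toH1 ((algebraMap ℤ_[p] (IwasawaAlgebra p) c) • a) = c • J.toH1 a
        rw [J.toH1_smul, PowerSeries.algebraMap_eq, PowerSeries.constantCoeff_C]) }
  have hf : Function.Injective f := by
    intro a b hab
    have h1 : layerZeroToTop W p κ (J.toH1 a) = layerZeroToTop W p κ (J.toH1 b) :=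
      congrArg Subtype.val hab
    have h2 : J.toH1 a = J.toH1 b := by
      rw [← sub_eq_zero] at h1 ⊢
      rw [← map_sub] at h1
      exact eq_zero_of_layerZeroToTop_eq_zero W p κ _ h1
    exact J.toH1_injective h2
  rw [hA]
  exact OrderHomClass.mono Cardinal.toENat (LinearMap.rank_le_of_injective f hf)

/-- **`1 ≤ ℓ_T(𝐇¹/T𝐇¹)` along a cyclotomic datum, from (12.2.2)** displayed as `h`: `𝐇¹` is finitely
generated (`IwasawaH1Data.module_finite_of_isCyclotomic`) and torsion free (`IwasawaH1Data.isTorsionFree`),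
tree theorems; `1 ≤ rank_Λ 𝐇¹` makes it non-trivial, and a non-zero finitely generated torsion-free
`Λ`-module has `ℓ_T` of its `Γ`-coinvariants `≥ 1` (`one_le_lengthAt_coinvariants_of_isTorsionFree`).
[cite: Kato2004Asterisque, §12.2 (12.2.1)–(12.2.2) (p. 220), Thm. 12.4 (2) (p. 221)] -/
theorem IwasawaH1Data.one_le_lengthAt_coinvariants_of_one_le_rank (h : one_le_rank_iwasawaH1)
    (hκ : κ.IsCyclotomic) (hγ : κ.IsTopGenerator γ) (I : IwasawaH1Data W p κ γ) :
    1 ≤ Module.lengthAt (IwasawaAlgebra p) (coinvariants p I.H) (primeT p) := by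
  haveI : Module.Finite (IwasawaAlgebra p) I.H := IwasawaH1Data.module_finite_of_isCyclotomic hκ hγ I
  haveI : Module.IsTorsionFree (IwasawaAlgebra p) I.H := I.isTorsionFree hγ
  haveI : Nontrivial I.H := nontrivial_of_one_le_rank_iwasawaH1 h W p κ γ hκ hγ I
  exact one_le_lengthAt_coinvariants_of_isTorsionFree p

/-- **The Poitou–Tate embedding `X₀(E/ℚ_∞) ↪ 𝐇²_Γ(T_pW)` at an ODD GOOD ORDINARY prime, Imai discharged:**
from the fact `exists_iwasawaH2Data_fineSelmerDual_embedding` displayed as `h`, for `W` globally minimal,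
`p ≠ 2` of good ordinary reduction (so `E(ℚ_{p,∞})[p^∞]` is finite —
`WeierstrassCurve.finite_fixedPoints_kerSubgroup_inf_decomp_of_ordinary`), `κ` cyclotomic with
topological generator `γ` and every pin `I`: a package `J` and an injective `e : X₀ →ₗ J.H2` with finite
cokernel. [cite: Kato2004Asterisque, (14.9.1) (p. 239), (14.14.1) (p. 243)] [cite: Imai1975, Theorem (p. 12)] -/
theorem exists_iwasawaH2Data_fineSelmerDual_embedding_of_goodOrdinary [W.IsGloballyMinimal]
    (h : exists_iwasawaH2Data_fineSelmerDual_embedding) (hp : p ≠ 2)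
    (hgood : W.HasGoodReductionAtPrime p) (hord : ¬ (p : ℤ) ∣ W.frobeniusTrace p)
    (hκ : κ.IsCyclotomic) (hγ : κ.IsTopGenerator γ) (I : IwasawaH1Data W p κ γ) :
    ∃ (J : IwasawaH2Data W p κ γ I) (e : (W.fineSelmerDualData κ hγ).X →ₗ[IwasawaAlgebra p] J.H2),
      Function.Injective e ∧ Finite (J.H2 ⧸ LinearMap.range e) := by
  set v : HeightOneSpectrum (𝓞 ℚ) :=
    Rat.HeightOneSpectrum.primesEquiv.symm ⟨p, (Fact.out : p.Prime)⟩ with hv_def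
  have hv : ((Rat.HeightOneSpectrum.primesEquiv v : Nat.Primes) : ℕ) = p := by
    rw [hv_def, Equiv.apply_symm_apply]
  have hfin := W.finite_fixedPoints_kerSubgroup_inf_decomp_of_ordinary κ hp hgood hord hκ v hv
  exact h W p κ γ hγ v hp hκ hv hfin I

end Kato2004

/-! ## §3 The descent count for the dual fine Selmer group -/

open Kato2004 in
/-- **The descent count (Kato (14.14.1) at `(T)`): `T`-semisimplicity of `X₀(E/ℚ_∞)` and
`rank_{ℤ_p} H¹(ℤ[1/p], T_pW) ≤ 2` give `ℓ_T(X₀(E/ℚ_∞)) ≤ 1`** — for `W/ℚ` globally minimal, `p ≠ 2` of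
good ordinary reduction, every cyclotomic `κ` with topological generator `γ`, `X₀ = (W.fineSelmerDualData κ hγ).X`,
relative to the two displayed construction facts `hPT` (Kato (14.9.1): `X₀ ↪ 𝐇²_Γ` with finite cokernel)
and `hrk` ((12.2.2): `𝐇¹_Γ ≠ 0`). Proof: `ℓ_T(X₀) = ℓ_T(X₀[T]) + ℓ_T(T·X₀) = ℓ_T(X₀[T]) ≤ ℓ_T(𝐇²[T])`,
and `1 + ℓ_T(𝐇²[T]) ≤ ℓ_T(𝐇¹/T𝐇¹) + ℓ_T(𝐇²[T]) = ℓ_T(A) ≤ rank_{ℤ_p} H¹(ℤ[1/p], T_pW) ≤ 2`. In print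
the hypotheses are Greenberg's semisimplicity of the fine dual at `T` (Kurihara–Pollack Problem 0.7 at
`(T)`) and «strict Selmer rank `≤ 1`» (Poitou–Tate); neither is asserted.
[cite: Kato2004Asterisque, §14.14 (14.14.1) (p. 243), (14.9.1) (p. 239), §12.2 (12.2.2) (p. 220)]
[cite: KuriharaPollack2007, Problem 0.7 (p. 352)] -/
theorem _root_.WeierstrassCurve.fineSelmerDual_lengthAt_le_one_of_TSubmodule_of_rank_le_two
    (W : WeierstrassCurve ℚ) [W.IsElliptic] [W.IsGloballyMinimal] {p : ℕ} [Fact p.Prime]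
    [ContinuousSMul ℤ_[p] (W.tateModule p)] {κ : ZpExtension ℚ p} {γ : absoluteGaloisGroup ℚ}
    (hPT : exists_iwasawaH2Data_fineSelmerDual_embedding) (hrk : one_le_rank_iwasawaH1)
    (hp : p ≠ 2) (hgood : W.HasGoodReductionAtPrime p) (hord : ¬ (p : ℤ) ∣ W.frobeniusTrace p)
    (hκ : κ.IsCyclotomic) (hγ : κ.IsTopGenerator γ)
    (hS1 : Module.lengthAt (IwasawaAlgebra p) ↥(TSubmodule p (W.fineSelmerDualData κ hγ).X) (primeT p) = 0)
    (hS2 : Module.rank ℤ_[p] ↥(integralH1 (tateRep W p) p ⊤) ≤ 2) :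
    Module.lengthAt (IwasawaAlgebra p) (W.fineSelmerDualData κ hγ).X (primeT p) ≤ 1 := by
  -- the pinned `𝐇¹` exists (tree theorem) and Kato's `𝐇²` package with `X₀ ↪ 𝐇²` (fact + Imai)
  obtain ⟨I⟩ := nonempty_iwasawaH1Data_holds W p κ γ hκ hγ
  obtain ⟨J, e, he, -⟩ :=
    exists_iwasawaH2Data_fineSelmerDual_embedding_of_goodOrdinary hPT hp hgood hord hκ hγ I
  -- the count
  have h1 : 1 ≤ Module.lengthAt (IwasawaAlgebra p) (coinvariants p I.H) (primeT p) :=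
    IwasawaH1Data.one_le_lengthAt_coinvariants_of_one_le_rank hrk hκ hγ I
  have hA := J.lengthAt_A_eq_coinvariants_add_invariants
  have hA2 : Module.lengthAt (IwasawaAlgebra p) J.A (primeT p) ≤ 2 :=
    J.lengthAt_A_le_toENat_rank_integralH1.trans (Cardinal.toENat_le_ofNat.mpr hS2)
  have hX : Module.lengthAt (IwasawaAlgebra p) (W.fineSelmerDualData κ hγ).X (primeT p) =
      Module.lengthAt (IwasawaAlgebra p) ↥(invariants p (W.fineSelmerDualData κ hγ).X) (primeT p) := by
    have h := lengthAt_eq_invariants_add_TSubmodule p (W.fineSelmerDualData κ hγ).X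
    rw [hS1, add_zero] at h
    exact h
  have hXH : Module.lengthAt (IwasawaAlgebra p) ↥(invariants p (W.fineSelmerDualData κ hγ).X) (primeT p) ≤
      Module.lengthAt (IwasawaAlgebra p) ↥(invariants p J.H2) (primeT p) :=
    IwasawaAlgebra.lengthAt_invariants_le_of_injective e he
  -- `1 + ℓ_T(𝐇²[T]) ≤ ℓ_T(𝐇¹/T𝐇¹) + ℓ_T(𝐇²[T]) = ℓ_T(A) ≤ 2`
  have hH2 : Module.lengthAt (IwasawaAlgebra p) ↥(invariants p J.H2) (primeT p) ≤ 1 := by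
    have h12 : (1 : ℕ∞) + Module.lengthAt (IwasawaAlgebra p) ↥(invariants p J.H2) (primeT p) ≤ 1 + 1 :=
      calc (1 : ℕ∞) + Module.lengthAt (IwasawaAlgebra p) ↥(invariants p J.H2) (primeT p)
          ≤ Module.lengthAt (IwasawaAlgebra p) (coinvariants p I.H) (primeT p) +
              Module.lengthAt (IwasawaAlgebra p) ↥(invariants p J.H2) (primeT p) :=
            add_le_add h1 le_rfl
        _ = Module.lengthAt (IwasawaAlgebra p) J.A (primeT p) := hA.symm
        _ ≤ 2 := hA2
    exact (ENat.add_le_add_iff_left ENat.one_ne_top).mp h12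
  rw [hX]
  exact hXH.trans hH2


/-! ## §4 (appended) The count with the `𝐇¹`-input PER PIN -/

open Kato2004 in
/-- **The descent count with the `𝐇¹`-input displayed per pin** (appended; same proof as
`WeierstrassCurve.fineSelmerDual_lengthAt_le_one_of_TSubmodule_of_rank_le_two` with the named fact
`one_le_rank_iwasawaH1` replaced by its only use, «`1 ≤ ℓ_T(𝐇¹/T𝐇¹)` for every cyclotomic pin» — so that a
consumer may supply it from another source, e.g. from one non-zero class in one pin transported by the
uniqueness of the pin): for `W/ℚ` globally minimal, `p ≠ 2` of good ordinary reduction, `κ` cyclotomic with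
topological generator `γ`, `ℓ_T(T·X₀) = 0` and `rank_{ℤ_p} H¹(ℤ[1/p], T_pW) ≤ 2` give `ℓ_T(X₀) ≤ 1`, modulo
the displayed fact `hPT` (Kato (14.9.1)) and the displayed per-pin bound `hH1`.
[cite: Kato2004Asterisque, §14.14 (14.14.1) (p. 243), (14.9.1) (p. 239)] -/
theorem _root_.WeierstrassCurve.fineSelmerDual_lengthAt_le_one_of_TSubmodule_of_rank_le_two'
    (W : WeierstrassCurve ℚ) [W.IsElliptic] [W.IsGloballyMinimal] {p : ℕ} [Fact p.Prime]
    [ContinuousSMul ℤ_[p] (W.tateModule p)] {κ : ZpExtension ℚ p} {γ : absoluteGaloisGroup ℚ}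
    (hPT : exists_iwasawaH2Data_fineSelmerDual_embedding)
    (hH1 : ∀ I : IwasawaH1Data W p κ γ,
      1 ≤ Module.lengthAt (IwasawaAlgebra p) (coinvariants p I.H) (primeT p))
    (hp : p ≠ 2) (hgood : W.HasGoodReductionAtPrime p) (hord : ¬ (p : ℤ) ∣ W.frobeniusTrace p)
    (hκ : κ.IsCyclotomic) (hγ : κ.IsTopGenerator γ)
    (hS1 : Module.lengthAt (IwasawaAlgebra p) ↥(TSubmodule p (W.fineSelmerDualData κ hγ).X) (primeT p) = 0)
    (hS2 : Module.rank ℤ_[p] ↥(integralH1 (tateRep W p) p ⊤) ≤ 2) :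
    Module.lengthAt (IwasawaAlgebra p) (W.fineSelmerDualData κ hγ).X (primeT p) ≤ 1 := by
  obtain ⟨I⟩ := nonempty_iwasawaH1Data_holds W p κ γ hκ hγ
  obtain ⟨J, e, he, -⟩ :=
    exists_iwasawaH2Data_fineSelmerDual_embedding_of_goodOrdinary hPT hp hgood hord hκ hγ I
  have h1 := hH1 I
  have hA := J.lengthAt_A_eq_coinvariants_add_invariants
  have hA2 : Module.lengthAt (IwasawaAlgebra p) J.A (primeT p) ≤ 2 :=
    J.lengthAt_A_le_toENat_rank_integralH1.trans (Cardinal.toENat_le_ofNat.mpr hS2)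
  have hX : Module.lengthAt (IwasawaAlgebra p) (W.fineSelmerDualData κ hγ).X (primeT p) =
      Module.lengthAt (IwasawaAlgebra p) ↥(invariants p (W.fineSelmerDualData κ hγ).X) (primeT p) := by
    have h := lengthAt_eq_invariants_add_TSubmodule p (W.fineSelmerDualData κ hγ).X
    rw [hS1, add_zero] at h
    exact h
  have hXH : Module.lengthAt (IwasawaAlgebra p) ↥(invariants p (W.fineSelmerDualData κ hγ).X) (primeT p) ≤
      Module.lengthAt (IwasawaAlgebra p) ↥(invariants p J.H2) (primeT p) :=
    IwasawaAlgebra.lengthAt_invariants_le_of_injective e he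
  have hH2 : Module.lengthAt (IwasawaAlgebra p) ↥(invariants p J.H2) (primeT p) ≤ 1 := by
    have h12 : (1 : ℕ∞) + Module.lengthAt (IwasawaAlgebra p) ↥(invariants p J.H2) (primeT p) ≤ 1 + 1 :=
      calc (1 : ℕ∞) + Module.lengthAt (IwasawaAlgebra p) ↥(invariants p J.H2) (primeT p)
          ≤ Module.lengthAt (IwasawaAlgebra p) (coinvariants p I.H) (primeT p) +
              Module.lengthAt (IwasawaAlgebra p) ↥(invariants p J.H2) (primeT p) :=
            add_le_add h1 le_rfl
        _ = Module.lengthAt (IwasawaAlgebra p) J.A (primeT p) := hA.symm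
        _ ≤ 2 := hA2
    exact (ENat.add_le_add_iff_left ENat.one_ne_top).mp h12
  rw [hX]
  exact hXH.trans hH2

end Literature.NumberTheory.EllipticCurves

end
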